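import Literature.AnabelianGeometry.SemiGraphs.PSCOpenInterOfUnrCharacters
import Literature.AnabelianGeometry.SemiGraphs.ProSigmaCompletionExtend
import Literature.AnabelianGeometry.SemiGraphs.ProSigmaCompletionInjective
import Literature.AnabelianGeometry.SemiGraphs.ProSigmaCompletionModels
import Literature.GroupTheory.CombinatorialGroupTheory.PuncturedSurfaceGroup
import HarnessLib

/-!
# PSC data of two-component shape (two vertices, one node): [CombGC] Prop. 1.2 (i) holds — the first genuine multi-vertex instance

Mochizuki, *A combinatorial version of the Grothendieck conjecture* [CombGC] §1, Prop. 1.2 (i) p. 8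
[cite: MochizukiCombGC2007, Prop 1.2(i) p.8].  The abc-iut FACT-LIST row F-0459 is the origin-level
statement `OpenInterDeterminesComponentHolds Ω` (`PSCGraphicity.lean`); its universal closure over all
`PSCDatum`s is refuted (`PSCGraphicityOriginClosure`), it holds at the one-vertex smooth-proper and
smooth-curve shapes (`PSCSmoothProperOrigin.lean`, `PSCSmoothCurveShape.lean`), and the cell's table
`PSC-ORIGIN-ROWS-STATUS.md` (abc-iut-L3-t4) records "What is NOT known in kernel: any row at genuine
MULTI-VERTEX data".  This PROOF-ONLY file (no definitions) supplies the first such instance.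

**The shape.**  `G : PSCDatum Π` has TWO-COMPONENT SHAPE of genera `(g₁, g₂)` (`g₁, g₂ ≥ 1`) if it is
what Def. 1.1 extracts from a pointed stable curve with two smooth components of genera `g₁`, `g₂`
meeting at ONE node and no marked points (dual semi-graph = one-node tree): along a pro-`Σ` completion
`ι : Γ_{g₁+g₂,0} → Π` of the surface group of the smoothing (specialisation isomorphism; handles
`a_i, b_i`, `i < g₁`, on the first component, `i ≥ g₁` on the second; vanishing cycle the separating
curve `z = ∏_{i<g₁} [a_i, b_i]`), `Π_{v₀} = cl ι⟨a_i, b_i : i < g₁⟩`, `Π_{v₁} = cl ι⟨a_i, b_i : i ≥ g₁⟩`,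
`Π_e = cl ι⟨z⟩` (contained in both: `z · ∏_{i≥g₁}[a_i,b_i]` is the relator), genera `g₁`, `g₂`.

**The argument.**  For `v ≠ w` the abelian characters `Γ_{g₁+g₂,0} → ℤ/ℓⁿ` (`ℓ ∈ Σ`), `a_{i₀} ↦ 1` for
one handle `i₀` of `v`, every other generator `↦ 0` (`PuncturedSurfaceGroup.exists_hom_of_comm`),
extend continuously to `Π` (`IsProSigmaCompletion.exists_continuous_extend_top`), kill `Π_w`, the node
group and `Ker(Π ↠ Π^unr)`, and are `1` on `ι(a_{i₀}) ∈ Π_v` (`exists_unrCharacters_of_twoComponent`);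
the criterion of `PSCOpenInterOfUnrCharacters.lean` then gives Prop. 1.2 (i).

**Result** `exists_twoComponentOrigin_holds`: the origin `Ω_tc` of all data of two-component shape
satisfies F-0459 and is INHABITED for every nonempty set of primes `Σ` and all `g₁, g₂ ≥ 1`
(`IsProSigmaCompletion.exists_isProSigmaCompletion`), by STURDY data when `g₁, g₂ ≥ 2` (so the
unramified conjunct is not vacuous).  NOT claimed (anabelian input on subsurface groups needed):
Prop. 1.2 (ii), 1.5 (i) and the separating-coverings rows at this shape.  A shape instance is
consistency evidence for the typed schema; no side taken on [IUTchIII] Cor. 3.12. -/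

noncomputable section

/-! ### Characters of punctured surface groups with commutative target -/

namespace Literature.GroupTheory.CombinatorialGroupTheory.PuncturedSurfaceGroup

variable {g r : ℕ}

/-- **Characters of `Γ_{g,r}` with commutative target**: any assignment of the handle generators
`a_i, b_i` to a commutative group, with every cusp generator `c_j ↦ 1`, extends to a homomorphism
`Γ_{g,r} → M` — the relator `∏[a_i,b_i]·∏c_j` maps to `1` (the abelian characters of the surface group,
[SemiAnbd] Ex. 2.10). [cite: MochizukiSemiAnbd2006, Ex. 2.10 p.31] -/
theorem exists_hom_of_comm {M : Type*} [CommGroup M] (f : puncturedSurfaceGen g r → M)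
    (hf : ∀ j, f (Sum.inr j) = 1) :
    ∃ φ : PuncturedSurfaceGroup g r →* M, ∀ x, φ (PresentedGroup.of x) = f x := by
  classical
  have hrel : ∀ v ∈ ({relator g r} : Set (FreeGroup (puncturedSurfaceGen g r))),
      FreeGroup.lift f v = 1 := by
    intro v hv
    rw [Set.mem_singleton_iff] at hv
    subst hv
    simp only [relator, map_mul, map_list_prod, List.map_map, Function.comp_def, map_inv, genA, genB,
      genC, FreeGroup.lift_apply_of]
    have h1 : ((List.finRange g).map fun i =>
        f (Sum.inl (i, false)) * f (Sum.inl (i, true)) * (f (Sum.inl (i, false)))⁻¹ *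
          (f (Sum.inl (i, true)))⁻¹).prod = 1 :=
      List.prod_eq_one fun y hy => by
        obtain ⟨i, -, rfl⟩ := List.mem_map.mp hy
        rw [mul_inv_cancel_comm, mul_inv_cancel]
    have h2 : ((List.finRange r).map fun k => f (Sum.inr k)).prod = 1 :=
      List.prod_eq_one fun y hy => by
        obtain ⟨j, -, rfl⟩ := List.mem_map.mp hy
        exact hf j
    rw [h1, h2, one_mul]
  exact ⟨PresentedGroup.toGroup hrel, fun x => PresentedGroup.toGroup.of hrel⟩

/-- The product of the first `g₁` commutators times the product of the last `g₂` commutators is the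
relator of `Γ_{g₁+g₂,0}`, hence trivial: the vanishing cycle `z = ∏_{i<g₁}[a_i,b_i]` of the
two-component degeneration equals `(∏_{j}[a_{g₁+j}, b_{g₁+j}])⁻¹`. [cite: MochizukiSemiAnbd2006, Ex. 2.10 p.31] -/
theorem prod_comm_castAdd_mul_prod_comm_natAdd (g₁ g₂ : ℕ) :
    (List.ofFn fun i : Fin g₁ =>
        a (g := g₁ + g₂) (r := 0) (Fin.castAdd g₂ i) * b (Fin.castAdd g₂ i) *
          (a (Fin.castAdd g₂ i))⁻¹ * (b (Fin.castAdd g₂ i))⁻¹).prod *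
      (List.ofFn fun j : Fin g₂ =>
        a (g := g₁ + g₂) (r := 0) (Fin.natAdd g₁ j) * b (Fin.natAdd g₁ j) *
          (a (Fin.natAdd g₁ j))⁻¹ * (b (Fin.natAdd g₁ j))⁻¹).prod = 1 := by
  -- the relator, split at `g₁`, at the free-group level
  let F : Fin (g₁ + g₂) → FreeGroup (puncturedSurfaceGen (g₁ + g₂) 0) := fun i =>
    genA (r := 0) i * genB (r := 0) i * (genA (r := 0) i)⁻¹ * (genB (r := 0) i)⁻¹
  have hrel_eq : relator (g₁ + g₂) 0 =
      ((List.ofFn fun i : Fin g₁ => F (Fin.castAdd g₂ i)) ++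
        List.ofFn fun j : Fin g₂ => F (Fin.natAdd g₁ j)).prod := by
    rw [relator, List.finRange_zero, List.map_nil, List.prod_nil, mul_one, ← List.ofFn_eq_map]
    exact congrArg List.prod (List.ofFn_add (f := F))
  have h1 := PresentedGroup.one_of_mem (rels := ({relator (g₁ + g₂) 0} : Set _))
    (Set.mem_singleton (relator (g₁ + g₂) 0))
  have h1' : PresentedGroup.mk ({relator (g₁ + g₂) 0} : Set _)
      ((List.ofFn fun i : Fin g₁ => F (Fin.castAdd g₂ i)) ++
        List.ofFn fun j : Fin g₂ => F (Fin.natAdd g₁ j)).prod = 1 := by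
    rw [← hrel_eq]; exact h1
  have key : ∀ i : Fin (g₁ + g₂), PresentedGroup.mk ({relator (g₁ + g₂) 0} : Set _) (F i) =
      a (g := g₁ + g₂) (r := 0) i * b i * (a i)⁻¹ * (b i)⁻¹ := fun i => by
    simp only [F, map_mul, map_inv]
    rfl
  simpa only [List.prod_append, map_mul, map_list_prod, List.map_ofFn, Function.comp_def, key]
    using h1'

end Literature.GroupTheory.CombinatorialGroupTheory.PuncturedSurfaceGroup

namespace Literature.AnabelianGeometry.SemiGraphs

open Multiplicative
open scoped Pointwise
open Literature.GroupTheory.CombinatorialGroupTheory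
open SemiGraphOfAnabelioids (IsProSigmaCompletion)
open Literature.AnabelianGeometry.Anabelioids (IsSigmaInteger)

universe u

namespace PSCDatum

variable {P : Type u} [Group P] [TopologicalSpace P] [IsTopologicalGroup P] [CompactSpace P]
  [TotallyDisconnectedSpace P]

/-! ### Data of two-component shape: the separating characters -/

section TwoComponent

variable {g₁ g₂ : ℕ}

/-- **Distinct vertices of a two-component datum are separated by unramified characters.**  For a
datum of two-component shape of genera `(g₁, g₂)` (`g₁, g₂ ≥ 1`) along a pro-`Σ` completion
`ι : Γ_{g₁+g₂,0} → Π`, `ℓ ∈ Σ` prime: for `v ≠ w` the continuous extensions of the characters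
`a_{i₀} ↦ 1` (one handle `i₀` of `v`), every other generator `↦ 0`, with values in `ℤ/ℓⁿ`, kill `Π_w`,
the node group `cl ι⟨∏_{i<g₁}[a_i,b_i]⟩` and `Ker(Π ↠ Π^unr)`, and are `1` on `ι(a_{i₀}) ∈ Π_v`.
[cite: MochizukiCombGC2007, Prop 1.2(i) p.8] -/
theorem exists_unrCharacters_of_twoComponent (G : PSCDatum P) {Sigma : Set ℕ} {ℓ : ℕ}
    (hℓ : ℓ.Prime) (hℓS : ℓ ∈ Sigma) (h₁ : 0 < g₁) (h₂ : 0 < g₂)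
    (ι : PuncturedSurfaceGroup (g₁ + g₂) 0 →* P) (hι : IsProSigmaCompletion Sigma ι)
    [IsEmpty G.graph.C] (v₀ v₁ : G.graph.V) (hV : ∀ w, w = v₀ ∨ w = v₁)
    (hV₀ : G.vertGp v₀ = ((Subgroup.closure
      (Set.range (fun i : Fin g₁ => PuncturedSurfaceGroup.a (r := 0) (Fin.castAdd g₂ i)) ∪
        Set.range (fun i : Fin g₁ => PuncturedSurfaceGroup.b (r := 0) (Fin.castAdd g₂ i)))).map
          ι).topologicalClosure)
    (hV₁ : G.vertGp v₁ = ((Subgroup.closure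
      (Set.range (fun j : Fin g₂ => PuncturedSurfaceGroup.a (r := 0) (Fin.natAdd g₁ j)) ∪
        Set.range (fun j : Fin g₂ => PuncturedSurfaceGroup.b (r := 0) (Fin.natAdd g₁ j)))).map
          ι).topologicalClosure)
    (hN : ∀ e, G.nodeGp e = ((Subgroup.zpowers (List.ofFn fun i : Fin g₁ =>
      PuncturedSurfaceGroup.a (g := g₁ + g₂) (r := 0) (Fin.castAdd g₂ i) *
        PuncturedSurfaceGroup.b (Fin.castAdd g₂ i) * (PuncturedSurfaceGroup.a (Fin.castAdd g₂ i))⁻¹ *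
          (PuncturedSurfaceGroup.b (Fin.castAdd g₂ i))⁻¹).prod).map ι).topologicalClosure) :
    ∀ v w : G.graph.V, v ≠ w → ∃ x ∈ G.vertGp v, ∀ n : ℕ,
      ∃ χ : P →* Multiplicative (ZMod (ℓ ^ n)),
        G.vertGp w ≤ χ.ker ∧ G.unrKer ≤ χ.ker ∧ χ x = ofAdd 1 := by
  classical
  -- the vanishing cycle
  set z : PuncturedSurfaceGroup (g₁ + g₂) 0 := (List.ofFn fun i : Fin g₁ =>
      PuncturedSurfaceGroup.a (g := g₁ + g₂) (r := 0) (Fin.castAdd g₂ i) *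
        PuncturedSurfaceGroup.b (Fin.castAdd g₂ i) * (PuncturedSurfaceGroup.a (Fin.castAdd g₂ i))⁻¹ *
          (PuncturedSurfaceGroup.b (Fin.castAdd g₂ i))⁻¹).prod with hz
  -- the character family attached to a handle generator `a_{i₀}`
  have hchar : ∀ (i₀ : Fin (g₁ + g₂)) (n : ℕ), ∃ χ : P →* Multiplicative (ZMod (ℓ ^ n)),
      Continuous χ ∧
      (∀ y : puncturedSurfaceGen (g₁ + g₂) 0, y ≠ Sum.inl (i₀, false) →
        χ (ι (PresentedGroup.of y)) = 1) ∧
      χ (ι z) = 1 ∧ χ (ι (PuncturedSurfaceGroup.a i₀)) = ofAdd 1 := by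
    intro i₀ n
    haveI : NeZero (ℓ ^ n) := ⟨pow_ne_zero n hℓ.ne_zero⟩
    let f : puncturedSurfaceGen (g₁ + g₂) 0 → Multiplicative (ZMod (ℓ ^ n)) := fun y =>
      if y = Sum.inl (i₀, false) then ofAdd 1 else 1
    obtain ⟨φ, hφ⟩ := PuncturedSurfaceGroup.exists_hom_of_comm f fun j => by simp [f]
    have hcard : IsSigmaInteger Sigma (Nat.card (Multiplicative (ZMod (ℓ ^ n)))) := by
      rw [show Nat.card (Multiplicative (ZMod (ℓ ^ n))) = ℓ ^ n from Nat.card_zmod (ℓ ^ n)]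
      exact SemiGraphOfAnabelioids.IsProSigmaCompletion.isSigmaInteger_prime_pow hℓ hℓS n
    obtain ⟨χ, hχc, hχ⟩ := hι.exists_continuous_extend_top hcard φ
    refine ⟨χ, hχc, fun y hy => ?_, ?_, ?_⟩
    · rw [hχ, hφ]; simp [f, hy]
    · rw [hχ, hz, map_list_prod, List.map_ofFn]
      exact List.prod_eq_one fun y hy => by
        obtain ⟨i, rfl⟩ := List.mem_ofFn.mp hy
        simp only [Function.comp_apply, map_mul, map_inv, mul_inv_cancel_comm, mul_inv_cancel]
    · rw [PuncturedSurfaceGroup.a, hχ, hφ]; simp [f]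
  -- from the character family to the separation statement
  have build : ∀ (v w : G.graph.V) (i₀ : Fin (g₁ + g₂)),
      ι (PuncturedSurfaceGroup.a i₀) ∈ G.vertGp v →
      (∀ (n : ℕ) (χ : P →* Multiplicative (ZMod (ℓ ^ n))), Continuous χ →
        (∀ y : puncturedSurfaceGen (g₁ + g₂) 0, y ≠ Sum.inl (i₀, false) →
          χ (ι (PresentedGroup.of y)) = 1) → G.vertGp w ≤ χ.ker) →
      ∃ x ∈ G.vertGp v, ∀ n : ℕ, ∃ χ : P →* Multiplicative (ZMod (ℓ ^ n)),
        G.vertGp w ≤ χ.ker ∧ G.unrKer ≤ χ.ker ∧ χ x = ofAdd 1 := by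
    intro v w i₀ hx hw
    refine ⟨ι (PuncturedSurfaceGroup.a i₀), hx, fun n => ?_⟩
    obtain ⟨χ, hχc, hgen, hχz, hχa⟩ := hchar i₀ n
    refine ⟨χ, hw n χ hχc hgen, ?_, hχa⟩
    refine G.unrKer_le_ker χ hχc (fun c => isEmptyElim c) fun e => ?_
    rw [hN e]
    exact topologicalClosure_map_zpowers_le_ker ι χ hχc z hχz
  -- membership of the distinguished generators
  have hx₀ : ι (PuncturedSurfaceGroup.a (Fin.castAdd g₂ ⟨0, h₁⟩)) ∈ G.vertGp v₀ := by
    rw [hV₀]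
    exact Subgroup.le_topologicalClosure _ (Subgroup.mem_map_of_mem ι
      (Subgroup.subset_closure (Or.inl ⟨⟨0, h₁⟩, rfl⟩)))
  have hx₁ : ι (PuncturedSurfaceGroup.a (Fin.natAdd g₁ ⟨0, h₂⟩)) ∈ G.vertGp v₁ := by
    rw [hV₁]
    exact Subgroup.le_topologicalClosure _ (Subgroup.mem_map_of_mem ι
      (Subgroup.subset_closure (Or.inl ⟨⟨0, h₂⟩, rfl⟩)))
  -- the generators of the OTHER vertex are killed
  have hw₁ : ∀ (n : ℕ) (χ : P →* Multiplicative (ZMod (ℓ ^ n))), Continuous χ →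
      (∀ y : puncturedSurfaceGen (g₁ + g₂) 0, y ≠ Sum.inl (Fin.castAdd g₂ ⟨0, h₁⟩, false) →
        χ (ι (PresentedGroup.of y)) = 1) → G.vertGp v₁ ≤ χ.ker := by
    intro n χ hχc hgen
    rw [hV₁]
    refine topologicalClosure_map_closure_le_ker ι χ hχc _ ?_
    rintro s (⟨j, rfl⟩ | ⟨j, rfl⟩)
    · refine hgen (Sum.inl (Fin.natAdd g₁ j, false)) fun h => ?_
      have h' := congrArg Fin.val (Prod.ext_iff.mp (Sum.inl_injective h)).1
      simp only [Fin.val_natAdd, Fin.val_castAdd] at h'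
      omega
    · exact hgen (Sum.inl (Fin.natAdd g₁ j, true)) (by simp)
  have hw₀ : ∀ (n : ℕ) (χ : P →* Multiplicative (ZMod (ℓ ^ n))), Continuous χ →
      (∀ y : puncturedSurfaceGen (g₁ + g₂) 0, y ≠ Sum.inl (Fin.natAdd g₁ ⟨0, h₂⟩, false) →
        χ (ι (PresentedGroup.of y)) = 1) → G.vertGp v₀ ≤ χ.ker := by
    intro n χ hχc hgen
    rw [hV₀]
    refine topologicalClosure_map_closure_le_ker ι χ hχc _ ?_
    rintro s (⟨i, rfl⟩ | ⟨i, rfl⟩)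
    · refine hgen (Sum.inl (Fin.castAdd g₂ i, false)) fun h => ?_
      have h' := congrArg Fin.val (Prod.ext_iff.mp (Sum.inl_injective h)).1
      simp only [Fin.val_natAdd, Fin.val_castAdd] at h'
      omega
    · exact hgen (Sum.inl (Fin.castAdd g₂ i, true)) (by simp)
  -- the two ordered pairs of distinct vertices
  intro v w hvw
  rcases hV v with rfl | rfl <;> rcases hV w with rfl | rfl
  · exact absurd rfl hvw
  · exact build _ _ _ hx₀ hw₁
  · exact build _ _ _ hx₁ hw₀
  · exact absurd rfl hvw

end TwoComponent

end PSCDatum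

/-! ### The two-component origin: inhabited (for every `Σ`, by sturdy data) and F-0459 holds -/

open PSCDatum in
/-- **F-0459 / [CombGC] Prop. 1.2 (i) at the first genuine MULTI-VERTEX origin.**  Let `Ω_tc` declare
"of PSC-type" exactly the data of TWO-COMPONENT SHAPE: `Π` profinite; two vertices `v₀ ≠ v₁`, one node
`e₀` with `nodeEnds e₀ = {v₀, v₁}`, no cusps; along a pro-`Σ` completion `ι : Γ_{g₁+g₂,0} → Π`
(`g₁, g₂ ≥ 1`, `Σ = G.Sigma`) `Π_{v₀} = cl ι⟨a_i, b_i : i < g₁⟩`, `Π_{v₁} = cl ι⟨a_i, b_i : i ≥ g₁⟩`,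
`Π_{e₀} = cl ι⟨∏_{i<g₁}[a_i,b_i]⟩`, genera `g₁`, `g₂` — what Def. 1.1 extracts from a stable curve with
two smooth components of genera `g₁, g₂` meeting at one node (specialisation isomorphism with the
smoothing of genus `g₁ + g₂`).  Then (1) `Ω_tc` is INHABITED for every nonempty set of primes `Σ` and
all `g₁, g₂ ≥ 1` (a pro-`Σ` completion exists: `exists_isProSigmaCompletion`; the node group lies in
BOTH verticial groups since `∏_{i<g₁}[a_i,b_i] · ∏_{i≥g₁}[a_i,b_i] = 1`), by STURDY data when
`g₁, g₂ ≥ 2`; (2) `OpenInterDeterminesComponentHolds Ω_tc` (row F-0459): verticial and unramified cases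
by separating unramified characters, edge-like case trivial (one edge).  First instance of a [CombGC]
§1 origin row at genuine data with more than one vertex; consistency evidence for the typed schema, not
the printed theorem for all pointed stable curves. [cite: MochizukiCombGC2007, Prop 1.2(i) p.8] -/
theorem exists_twoComponentOrigin_holds :
    ∃ Ω : PSCOrigin.{0},
      (∀ (S : Set ℕ), S.Nonempty → (∀ p ∈ S, p.Prime) → ∀ g₁ g₂ : ℕ, 0 < g₁ → 0 < g₂ →
        ∃ (Q : ProfiniteGrp.{0}) (ι : PuncturedSurfaceGroup (g₁ + g₂) 0 →* Q) (G : PSCDatum Q),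
          IsProSigmaCompletion S ι ∧ Ω.IsOfPSCType G ∧ G.Sigma = S ∧
          G.graph.i = 2 ∧ G.graph.n = 1 ∧ G.graph.r = 0 ∧
          (∃ v₀ v₁ : G.graph.V, v₀ ≠ v₁ ∧ G.genus v₀ = g₁ ∧ G.genus v₁ = g₂ ∧
            G.vertGp v₀ = ((Subgroup.closure
              (Set.range (fun i : Fin g₁ => PuncturedSurfaceGroup.a (r := 0) (Fin.castAdd g₂ i)) ∪
                Set.range (fun i : Fin g₁ => PuncturedSurfaceGroup.b (r := 0) (Fin.castAdd g₂ i)))).map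
                  ι).topologicalClosure ∧
            G.vertGp v₁ = ((Subgroup.closure
              (Set.range (fun j : Fin g₂ => PuncturedSurfaceGroup.a (r := 0) (Fin.natAdd g₁ j)) ∪
                Set.range (fun j : Fin g₂ => PuncturedSurfaceGroup.b (r := 0) (Fin.natAdd g₁ j)))).map
                  ι).topologicalClosure ∧
            ∀ e, G.graph.nodeEnds e = s(v₀, v₁) ∧
              G.nodeGp e = ((Subgroup.zpowers (List.ofFn fun i : Fin g₁ =>
                PuncturedSurfaceGroup.a (g := g₁ + g₂) (r := 0) (Fin.castAdd g₂ i) *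
                  PuncturedSurfaceGroup.b (Fin.castAdd g₂ i) *
                    (PuncturedSurfaceGroup.a (Fin.castAdd g₂ i))⁻¹ *
                      (PuncturedSurfaceGroup.b (Fin.castAdd g₂ i))⁻¹).prod).map ι).topologicalClosure) ∧
          (2 ≤ g₁ → 2 ≤ g₂ → G.IsSturdy)) ∧
      OpenInterDeterminesComponentHolds Ω := by
  classical
  -- the origin: data of two-component shape
  let Ω : PSCOrigin.{0} :=
    ⟨fun {Q} _ _ G => ∃ (_ : IsTopologicalGroup Q), CompactSpace Q ∧ TotallyDisconnectedSpace Q ∧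
      IsEmpty G.graph.C ∧
      ∃ (g₁ g₂ : ℕ) (ι : PuncturedSurfaceGroup (g₁ + g₂) 0 →* Q) (v₀ v₁ : G.graph.V)
        (e₀ : G.graph.N), 0 < g₁ ∧ 0 < g₂ ∧ IsProSigmaCompletion G.Sigma ι ∧ v₀ ≠ v₁ ∧
        (∀ w, w = v₀ ∨ w = v₁) ∧ (∀ e, e = e₀) ∧ G.graph.nodeEnds e₀ = s(v₀, v₁) ∧
        G.genus v₀ = g₁ ∧ G.genus v₁ = g₂ ∧
        G.vertGp v₀ = ((Subgroup.closure
          (Set.range (fun i : Fin g₁ => PuncturedSurfaceGroup.a (r := 0) (Fin.castAdd g₂ i)) ∪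
            Set.range (fun i : Fin g₁ => PuncturedSurfaceGroup.b (r := 0) (Fin.castAdd g₂ i)))).map
              ι).topologicalClosure ∧
        G.vertGp v₁ = ((Subgroup.closure
          (Set.range (fun j : Fin g₂ => PuncturedSurfaceGroup.a (r := 0) (Fin.natAdd g₁ j)) ∪
            Set.range (fun j : Fin g₂ => PuncturedSurfaceGroup.b (r := 0) (Fin.natAdd g₁ j)))).map
              ι).topologicalClosure ∧
        G.nodeGp e₀ = ((Subgroup.zpowers (List.ofFn fun i : Fin g₁ =>
          PuncturedSurfaceGroup.a (g := g₁ + g₂) (r := 0) (Fin.castAdd g₂ i) *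
            PuncturedSurfaceGroup.b (Fin.castAdd g₂ i) * (PuncturedSurfaceGroup.a (Fin.castAdd g₂ i))⁻¹ *
              (PuncturedSurfaceGroup.b (Fin.castAdd g₂ i))⁻¹).prod).map ι).topologicalClosure⟩
  refine ⟨Ω, fun S hne hprime g₁ g₂ h₁ h₂ => ?_, ?_⟩
  · -- (1) the inhabitant over a pro-`Σ` completion of `Γ_{g₁+g₂,0}`
    obtain ⟨Q, ι, hι⟩ := SemiGraphOfAnabelioids.IsProSigmaCompletion.exists_isProSigmaCompletion
      (PuncturedSurfaceGroup (g₁ + g₂) 0) S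
    -- the two verticial groups and the node group
    let A₀ : Subgroup Q := ((Subgroup.closure
      (Set.range (fun i : Fin g₁ => PuncturedSurfaceGroup.a (r := 0) (Fin.castAdd g₂ i)) ∪
        Set.range (fun i : Fin g₁ => PuncturedSurfaceGroup.b (r := 0) (Fin.castAdd g₂ i)))).map
          ι).topologicalClosure
    let A₁ : Subgroup Q := ((Subgroup.closure
      (Set.range (fun j : Fin g₂ => PuncturedSurfaceGroup.a (r := 0) (Fin.natAdd g₁ j)) ∪
        Set.range (fun j : Fin g₂ => PuncturedSurfaceGroup.b (r := 0) (Fin.natAdd g₁ j)))).map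
          ι).topologicalClosure
    let z : PuncturedSurfaceGroup (g₁ + g₂) 0 := (List.ofFn fun i : Fin g₁ =>
      PuncturedSurfaceGroup.a (g := g₁ + g₂) (r := 0) (Fin.castAdd g₂ i) *
        PuncturedSurfaceGroup.b (Fin.castAdd g₂ i) * (PuncturedSurfaceGroup.a (Fin.castAdd g₂ i))⁻¹ *
          (PuncturedSurfaceGroup.b (Fin.castAdd g₂ i))⁻¹).prod
    let z' : PuncturedSurfaceGroup (g₁ + g₂) 0 := (List.ofFn fun j : Fin g₂ =>
      PuncturedSurfaceGroup.a (g := g₁ + g₂) (r := 0) (Fin.natAdd g₁ j) *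
        PuncturedSurfaceGroup.b (Fin.natAdd g₁ j) * (PuncturedSurfaceGroup.a (Fin.natAdd g₁ j))⁻¹ *
          (PuncturedSurfaceGroup.b (Fin.natAdd g₁ j))⁻¹).prod
    let Z : Subgroup Q := ((Subgroup.zpowers z).map ι).topologicalClosure
    -- `z` lies in both handle groups: directly, and via the relator `z · z' = 1`
    have hz₀ : z ∈ Subgroup.closure
        (Set.range (fun i : Fin g₁ => PuncturedSurfaceGroup.a (g := g₁ + g₂) (r := 0) (Fin.castAdd g₂ i)) ∪
          Set.range (fun i : Fin g₁ => PuncturedSurfaceGroup.b (g := g₁ + g₂) (r := 0) (Fin.castAdd g₂ i))) := by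
      refine Subgroup.list_prod_mem _ fun y hy => ?_
      obtain ⟨i, rfl⟩ := List.mem_ofFn.mp hy
      exact mul_mem (mul_mem (mul_mem (Subgroup.subset_closure (Or.inl ⟨i, rfl⟩))
        (Subgroup.subset_closure (Or.inr ⟨i, rfl⟩)))
          (inv_mem (Subgroup.subset_closure (Or.inl ⟨i, rfl⟩))))
            (inv_mem (Subgroup.subset_closure (Or.inr ⟨i, rfl⟩)))
    have hz'₁ : z' ∈ Subgroup.closure
        (Set.range (fun j : Fin g₂ => PuncturedSurfaceGroup.a (g := g₁ + g₂) (r := 0) (Fin.natAdd g₁ j)) ∪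
          Set.range (fun j : Fin g₂ => PuncturedSurfaceGroup.b (g := g₁ + g₂) (r := 0) (Fin.natAdd g₁ j))) := by
      refine Subgroup.list_prod_mem _ fun y hy => ?_
      obtain ⟨j, rfl⟩ := List.mem_ofFn.mp hy
      exact mul_mem (mul_mem (mul_mem (Subgroup.subset_closure (Or.inl ⟨j, rfl⟩))
        (Subgroup.subset_closure (Or.inr ⟨j, rfl⟩)))
          (inv_mem (Subgroup.subset_closure (Or.inl ⟨j, rfl⟩))))
            (inv_mem (Subgroup.subset_closure (Or.inr ⟨j, rfl⟩)))
    have hzz' : z = z'⁻¹ :=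
      eq_inv_of_mul_eq_one_left (PuncturedSurfaceGroup.prod_comm_castAdd_mul_prod_comm_natAdd g₁ g₂)
    have hZ₀ : Z ≤ A₀ :=
      Subgroup.topologicalClosure_mono (Subgroup.map_mono ((Subgroup.zpowers_le).mpr hz₀))
    have hZ₁ : Z ≤ A₁ :=
      Subgroup.topologicalClosure_mono (Subgroup.map_mono ((Subgroup.zpowers_le).mpr
        (by rw [hzz']; exact inv_mem hz'₁)))
    -- the datum
    let G : PSCDatum Q :=
      { Sigma := S
        sigma_prime := hprime
        sigma_nonempty := hne
        graph := { V := Bool, N := Unit, C := Empty, nodeEnds := fun _ => s(false, true),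
                   cuspEnd := Empty.elim }
        vertGp := fun v => cond v A₁ A₀
        nodeGp := fun _ => Z
        cuspGp := fun c => Empty.elim c
        genus := fun v => cond v g₂ g₁
        isClosed_vertGp := fun v => by cases v <;> exact Subgroup.isClosed_topologicalClosure _
        isClosed_nodeGp := fun _ => Subgroup.isClosed_topologicalClosure _
        isClosed_cuspGp := fun c => Empty.elim c
        nodeGp_le := fun _ => ⟨false, true, rfl, ⟨1, by rw [one_smul]; exact hZ₀⟩,
          ⟨1, by rw [one_smul]; exact hZ₁⟩⟩
        cuspGp_le := fun c => Empty.elim c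
        proSigma := ⟨fun U _ p hp hdvd =>
          (hι.index_open U.toSubgroup U.isNormal' U.isOpen').2 p hp hdvd⟩ }
    have hG : Ω.IsOfPSCType G :=
      ⟨inferInstance, inferInstance, inferInstance, inferInstanceAs (IsEmpty Empty), g₁, g₂, ι, false,
        true, (), h₁, h₂, hι, Bool.false_ne_true, fun w => by cases w <;> simp, fun _ => rfl, rfl, rfl,
        rfl, rfl, rfl, rfl⟩
    refine ⟨Q, ι, G, hι, hG, rfl, rfl, rfl, rfl, ⟨false, true, Bool.false_ne_true, rfl, rfl, rfl, rfl,
      fun _ => ⟨rfl, rfl⟩⟩, fun hg₁ hg₂ v => ?_⟩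
    cases v
    · exact hg₁
    · exact hg₂
  · -- (2) F-0459 at `Ω_tc`
    refine openInterDeterminesComponentHolds_of_unrCharacters Ω fun Q _ _ _ G hG => ?_
    obtain ⟨_, hcpt, htd, hC, g₁, g₂, ι, v₀, v₁, e₀, h₁, h₂, hι, hv, hV, hE, -, -, -, hV₀, hV₁, hN⟩ := hG
    haveI := hcpt
    haveI := htd
    haveI := hC
    have hsub : Subsingleton (G.graph.N ⊕ G.graph.C) := ⟨fun x y => by
      rcases x with e | c
      · rcases y with e' | c
        · rw [hE e, hE e']
        · exact isEmptyElim c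
      · exact isEmptyElim c⟩
    obtain ⟨ℓ, hℓS⟩ := G.sigma_nonempty
    have hℓ : ℓ.Prime := G.sigma_prime ℓ hℓS
    refine ⟨hcpt, htd, hsub, ℓ, hℓ.one_lt, ?_⟩
    exact G.exists_unrCharacters_of_twoComponent hℓ hℓS h₁ h₂ ι hι v₀ v₁ hV hV₀ hV₁ fun e => by
      rw [hE e]; exact hN

end Literature.AnabelianGeometry.SemiGraphs

end
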